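/-
Copyright: seat `ym-line-cbag-p2` (prover-ym-line-cbag-p2-g0-0), route `ColdBoxAllGroups`, crux `BulkAllGroups`
(stmt-QuantumFields-22255), line `dlr-chessboard-G` (skeleton `Cruxes/BulkAllGroups/Lines/birth.lean`).
-/
import Summits.QuantumFields.YangMills.Theorems.ColdBoxAllGroupsDefs
import Summits.QuantumFields.YangMills.Theorems.WeakCouplingRatesBulkDominatesColdBoxWCrudeGoodGauge

/-!
# A crude-good boundary datum is, up to gauge, a SMALL-LINK datum on the corona box — any compact `G` (brick B4-G toward the open stubs
# N2-cov-G / N2-mean-G of crux `BulkAllGroups`, stmt-QuantumFields-22255); G-port of `WeakCouplingRatesBulkDominatesColdBoxWCrudeGoodGauge`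

WHY.  The open stubs `stub_kernelCovExpansionG` / `stub_kernelMeanExpansionG` concern the box kernel `boxKernelG ρ β H ω` uniformly over
`CrudeGoodG ρ β δ H ω` (every plaquette of `ω` based in the corona range `[−1, 2H+1]⁴` has cost `N − Re tr ρ(ω_p) ≤ β^{2δ−1}`).  Kernel means of
gauge-invariant observables are gauge invariant in `ω` (tree `integral_ymSpecification_gaugeTransformZd`, G-generic) and read `ω` only on the
collar of the box, which lies inside the edge set of the corona vertex box `{−1,…,2H+1}⁴`.  This file supplies the gauge for ANY compact `G` with a
unitary representation `ρ` of degree `N ≥ 1`: for crude-good `ω` there is a gauge transformation `g` of `ℤ⁴` such that EVERY link of `ω^g` of the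
corona vertex box is within `a = 4·(2H+3)·√(2β^{2δ−1})` of `1` in the operator norm along `ρ` (`exists_gauge_opDist1_le_of_crudeGoodG`) —
Chatterjee's comb gauge on the translated box (tree `AxialGauge.gaugeFix`) and the SUP form of the discrete Poincaré inequality (G-generic tree
`AxialGaugeSup.le_mul_of_plaquette_le_gaugeFix`) for the length function `ℓ = opDist1 ∘ ρ = ‖ρ(·) − 1‖_op` (`opDist1_map_mul_le/inv/conj`,
unitary `ρ`), with `ℓ(U_p)² ≤ 2·(N − Re tr ρ U_p)` (`MatrixNorms.opDist1_sq_le_card_mul`).  NOT a claim about the mass gap; the Yang–Mills mass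
gap is NOT proved by any of this.

References: S. Chatterjee, arXiv:1602.01222, §9 and Lemma 10.2; T. Bałaban, CMP 98 (1985) (19).
-/

set_option autoImplicit false

noncomputable section

open Finset
open scoped Matrix.Norms.L2Operator
open Literature.Probability.LatticeModels Literature.MathematicalPhysics Literature.MathematicalPhysics.QuantumLattice
open Literature.MathematicalPhysics.QuantumFieldTheory Literature.MathematicalPhysics.QuantumFieldTheory.AxialGauge
open Literature.MathematicalPhysics.QuantumFieldTheory.Balaban1983to89 Literature.MathematicalPhysics.QuantumFieldTheory.Balaban1983to89.UnitaryModel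
open Summit.QuantumFields.YangMills.Theorems.WeakCouplingRates

namespace Summit.QuantumFields.YangMills.Theorems.ColdBoxAllGroups

variable {N : ℕ} [NeZero N] {G : Type*} [Group G] [TopologicalSpace G] [IsTopologicalGroup G] [CompactSpace G]
  [MeasurableSpace G] [BorelSpace G]
variable (ρ : G →* Matrix (Fin N) (Fin N) ℂ) (hρu : ∀ g, ρ g ∈ Matrix.unitaryGroup (Fin N) ℂ)
include hρu

omit [TopologicalSpace G] [IsTopologicalGroup G] [CompactSpace G] [MeasurableSpace G] [BorelSpace G] in
/-- For a unitary `ρ` of degree `N ≥ 1`: `‖ρ(U) − 1‖²_op ≤ 2·(N − Re tr ρ(U))` (`= 2 c_p` for a plaquette variable).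
[cite: Balaban1987RG1, (0.14) p.254] -/
theorem opDist1_sq_le_two_mul_costG (U : G) :
    opDist1 (ρ U) ^ 2 ≤ 2 * ((N : ℝ) - (ρ U).trace.re) := by
  have h := MatrixNorms.opDist1_sq_le_card_mul (n := Fin N) (hρu U)
  have hN : (N : ℝ) ≠ 0 := by exact_mod_cast NeZero.ne N
  simp only [nReTr, Fintype.card_fin] at h
  have e : (N : ℝ) * (2 * (1 - (ρ U).trace.re / (N : ℝ))) = 2 * ((N : ℝ) - (ρ U).trace.re) := by
    field_simp
  linarith [e ▸ h]

omit [TopologicalSpace G] [IsTopologicalGroup G] [CompactSpace G] [MeasurableSpace G] [BorelSpace G] in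
/-- `‖ρ(U) − 1‖_op ≤ √(2t)` when the plaquette cost `N − Re tr ρ(U)` is `≤ t`. [folklore] -/
theorem opDist1_le_sqrt_of_cost_leG {U : G} {t : ℝ}
    (h : (N : ℝ) - (ρ U).trace.re ≤ t) :
    opDist1 (ρ U) ≤ Real.sqrt (2 * t) := by
  have h2 := opDist1_sq_le_two_mul_costG ρ hρu U
  have h3 : opDist1 (ρ U) ^ 2 ≤ 2 * t := by linarith
  calc opDist1 (ρ U) = Real.sqrt (opDist1 (ρ U) ^ 2) := by
        rw [Real.sqrt_sq (opDist1_nonneg _)]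
    _ ≤ Real.sqrt (2 * t) := Real.sqrt_le_sqrt h3

omit [TopologicalSpace G] [IsTopologicalGroup G] [CompactSpace G] [BorelSpace G] in
/-- **Crude-good ⇒ small links, up to gauge**, any compact `G`, unitary `ρ` of degree `N ≥ 1`.  If every plaquette of `ω : ℤ⁴ → G` based in the corona range `[−1, 2H+1]⁴` has cost
`≤ β^{2δ−1}` (`CrudeGoodG ρ β δ H ω`), there is a gauge transformation `g` such that every link `(y − (1,1,1,1), i)` of `ω^g` with
`(y, i)` an edge of Chatterjee's cube `[0, 2H+3)⁴` — i.e. every edge of the corona vertex box `{−1,…,2H+1}⁴` — satisfies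
`‖ρ((ω^g)_e) − 1‖_op ≤ 4·(2H+3)·√(2β^{2δ−1})` (comb gauge of the translated datum + the sup Poincaré inequality; the collar of the box
`boxEdges 4 (2H+1)` consists of such edges).  For `β ≥ 1` and `δ = θ/5`, `H = ⌈β^θ⌉`, the radius is `≲ 12·β^{1.2θ − 1/2}`. [folklore] -/
theorem exists_gauge_opDist1_le_of_crudeGoodG {β δ : ℝ} {H : ℕ} {ω : LGConfig 4 G}
    (hω : CrudeGoodG ρ β δ H ω) :
    ∃ g : Literature.Probability.LatticeModels.Site 4 → G,
      ∀ (y : Literature.Probability.LatticeModels.Site 4) (i : Fin 4), (y, i) ∈ boxEdges 4 (2 * H + 3) →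
        opDist1 (ρ (gaugeTransformZd g ω (y - (fun _ => 1), i))) ≤
          4 * (2 * H + 3 : ℕ) * Real.sqrt (2 * β ^ (2 * δ - 1)) := by
  set onesSite : Literature.Probability.LatticeModels.Site 4 := fun _ => 1 with hones
  -- translate the datum: `U (y, i) = ω (y − 1⃗, i)`
  set U : ZdGaugeConfig 4 G := configShift onesSite ω with hU
  have hUapp : ∀ (y : Literature.Probability.LatticeModels.Site 4) (i : Fin 4), U (y, i) = ω (y - onesSite, i) := fun y i => by
    rw [hU, QuantumLattice.configShift_apply]
  -- the plaquettes of `U` in the cube are small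
  set M : ℝ := Real.sqrt (2 * β ^ (2 * δ - 1)) with hM
  have hM0 : 0 ≤ M := Real.sqrt_nonneg _
  have hplaq : ∀ p ∈ plaquettesIn (halfOpenBox 4 (2 * H + 3)), opDist1 (ρ (U.plaquette p.1 p.2.1 p.2.2)) ≤ M := by
    intro p hp
    obtain ⟨hy, hij, -, -, hyij⟩ := Plaq.mem_plaquettesIn.1 hp
    rw [mem_halfOpenBox] at hy hyij
    have hhol : U.plaquette p.1 p.2.1 p.2.2 = plaquetteHolonomyZd ω (p.1 - onesSite) p.2.1 p.2.2 := by
      rw [hU, show ZdGaugeConfig.plaquette (configShift onesSite ω) p.1 p.2.1 p.2.2 =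
        plaquetteHolonomyZd (configShift onesSite ω) p.1 p.2.1 p.2.2 from rfl, plaquetteHolonomyZd_configShift]
    have hrange : ∀ k : Fin 4, (-1 : ℤ) ≤ (p.1 - onesSite) k ∧ (p.1 - onesSite) k ≤ 2 * (H : ℤ) + 1 := by
      intro k
      have h1 := hy k
      have h2 := hyij k
      simp only [Pi.add_apply, Pi.single_apply] at h2
      simp only [Pi.sub_apply, hones]
      split_ifs at h2 <;> push_cast at h1 h2 ⊢ <;> omega
    have hcost := hω (p.1 - onesSite) hrange p.2.1 p.2.2 hij
    simp only [plaqCostAt, plaquetteObs] at hcost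
    rw [hhol]
    exact opDist1_le_sqrt_of_cost_leG ρ hρu hcost
  -- comb gauge + the sup Poincaré inequality
  refine ⟨fun x => combGauge U (x + onesSite), fun y i hyi => ?_⟩
  have key := (AxialGaugeSup.le_mul_of_plaquette_le_gaugeFix (ℓ := fun h => opDist1 (ρ h))
    (fun a b => opDist1_map_mul_le ρ hρu a b) (fun a => opDist1_map_inv ρ hρu a) (by simp [opDist1_one])
    (fun g h => opDist1_map_conj ρ hρu g h) U hM0 hplaq hyi).2
  -- identify `(ω^g)(y − 1⃗, i)` with `(gaugeFix U)(y, i)`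
  have e1 : y - onesSite + onesSite = y := sub_add_cancel y onesSite
  have e2 : y - onesSite + Pi.single i 1 + onesSite = y + Pi.single i 1 := by
    rw [add_right_comm, sub_add_cancel]
  have hid : gaugeTransformZd (fun x => combGauge U (x + onesSite)) ω (y - onesSite, i) = gaugeFix U (y, i) := by
    show combGauge U (y - onesSite + onesSite) * ω (y - onesSite, i) *
        (combGauge U (y - onesSite + Pi.single i 1 + onesSite))⁻¹ = gaugeFix U (y, i)
    rw [e1, e2, gaugeFix_apply, hUapp]
  rw [hid]
  calc opDist1 (ρ (gaugeFix U (y, i))) ≤ ((4 : ℕ) : ℝ) * ((2 * H + 3 : ℕ) : ℝ) * M := key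
    _ = 4 * ((2 * H + 3 : ℕ) : ℝ) * Real.sqrt (2 * β ^ (2 * δ - 1)) := by rw [hM]; norm_num

end Summit.QuantumFields.YangMills.Theorems.ColdBoxAllGroups

end
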